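import Mathlib.Analysis.SpecialFunctions.Sqrt
import HarnessLib

/-!
# Exponent bookkeeping in Bamler's Gaussian lemma

A pure real inequality: the estimate of the exponent of display (7.24) in the proof of the
Gaussian lemma of [Bamler 2020a, §7.3] (arXiv Lemma 28), obtained from the distance bookkeeping
(7.25) and the parameter choices (7.26).

With `d = d₀(y₁, y₂)`, `dᵢ = d₀(zᵢ, yᵢ)`, `dv = d_θ(v₁, v₂)` and the triangle-type inequality
`d ≤ d₁ + d₂ + dv + 2 √(H θ τ)`, the weighted Young inequality
`(a + b)² ≤ (1 + β) a² + (1 + 1/β) b²` and `(x + y + z)² ≤ 3 (x² + y² + z²)` give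

  `d² ≤ (1 + β) dv² + 3 (1 + 1/β) (d₁² + d₂² + 4 H θ τ)`,

hence (Bamler's display (7.25), after multiplication by `(1 + β)²` and the splitting
`(1 + β) d² = -β (1 + β) d² + (1 + β)² d²`)

  `(1 + β) d² ≤ -β (1 + β) d² + (1 + β)³ dv² + 3 (1 + β)³ / β · (d₁² + d₂² + 4 H θ τ)`.

Dividing by `(8 + ε/2) τ` and using the parameter choices `(1 + β)³ / (8 + ε/2) ≤ 1/8`
(which, together with `σ ≤ τ`, absorbs the `dv²` term into `dv² / (8 σ)`) and
`3 (1 + β)³ / (β (8 + ε/2)) ≤ β / (Q θ)` (which absorbs the `d₁² + d₂²` term), one obtains the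
registered inequality `gaussianLemma_exponent_le`.

## References

* R. H. Bamler, *Entropy and heat kernel bounds on a Ricci flow background* (2020), §7.3, proof of
  the Gaussian lemma, displays (7.25)–(7.26). [cite: Bamler2020Entropy, §7.3, (7.25)–(7.26)]
-/

noncomputable section

namespace Literature.Geometry.Riemannian

/-- Weighted Young inequality for the square of a sum: `(a + b)² ≤ (1 + β) a² + (1 + 1/β) b²`
for `β > 0` (from `2ab ≤ β a² + b²/β`). [folklore] -/
theorem gaussianLemma_add_sq_le_weighted {β : ℝ} (hβ : 0 < β) (a b : ℝ) :
    (a + b) ^ 2 ≤ (1 + β) * a ^ 2 + (1 + 1 / β) * b ^ 2 := by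
  rw [← sub_nonneg]
  have hid : (1 + β) * a ^ 2 + (1 + 1 / β) * b ^ 2 - (a + b) ^ 2 = (β * a - b) ^ 2 / β := by
    field_simp
    ring
  rw [hid]
  positivity

/-- First half of Bamler's display (7.25): from `0 ≤ d ≤ d₁ + d₂ + dv + 2 √(H θ τ)`
(`d₁, d₂, H, θ, τ ≥ 0`) and `β > 0`,
`d² ≤ (1 + β) dv² + 3 (1 + 1/β) (d₁² + d₂² + 4 H θ τ)`.
[cite: Bamler2020Entropy, §7.3, (7.25)] -/
theorem gaussianLemma_sq_le {β H θ τ d dv d₁ d₂ : ℝ} (hβ : 0 < β) (hH : 0 ≤ H) (hθ : 0 ≤ θ)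
    (hτ : 0 ≤ τ) (hd : 0 ≤ d) (hd₁ : 0 ≤ d₁) (hd₂ : 0 ≤ d₂)
    (htri : d ≤ d₁ + d₂ + dv + 2 * Real.sqrt (H * θ * τ)) :
    d ^ 2 ≤ (1 + β) * dv ^ 2 + 3 * (1 + 1 / β) * (d₁ ^ 2 + d₂ ^ 2 + 4 * (H * θ * τ)) := by
  have hW : 0 ≤ H * θ * τ := mul_nonneg (mul_nonneg hH hθ) hτ
  set r := Real.sqrt (H * θ * τ) with hr_def
  have hr0 : 0 ≤ r := Real.sqrt_nonneg _
  have hr2 : r ^ 2 = H * θ * τ := Real.sq_sqrt hW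
  -- `d ≤ dv + S` with `S = d₁ + d₂ + 2 r ≥ 0`
  have hS0 : 0 ≤ d₁ + d₂ + 2 * r := by positivity
  have hdS : d ≤ dv + (d₁ + d₂ + 2 * r) := by linarith
  have hd2 : d ^ 2 ≤ (dv + (d₁ + d₂ + 2 * r)) ^ 2 := pow_le_pow_left₀ hd hdS 2
  -- weighted Young
  have hyoung := gaussianLemma_add_sq_le_weighted hβ dv (d₁ + d₂ + 2 * r)
  -- `S² ≤ 3 (d₁² + d₂² + 4 H θ τ)` (Cauchy–Schwarz with three terms, `(2r)² = 4 H θ τ`)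
  have hS2 : (d₁ + d₂ + 2 * r) ^ 2 ≤ 3 * (d₁ ^ 2 + d₂ ^ 2 + 4 * (H * θ * τ)) := by
    calc (d₁ + d₂ + 2 * r) ^ 2 ≤ 3 * (d₁ ^ 2 + d₂ ^ 2 + (2 * r) ^ 2) := by
          nlinarith [sq_nonneg (d₁ - d₂), sq_nonneg (d₁ - 2 * r), sq_nonneg (d₂ - 2 * r)]
      _ = 3 * (d₁ ^ 2 + d₂ ^ 2 + 4 * (H * θ * τ)) := by rw [mul_pow, hr2]; norm_num
  have h1β : 0 ≤ 1 + 1 / β := by positivity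
  have hS2' := mul_le_mul_of_nonneg_left hS2 h1β
  linarith [hd2, hyoung, hS2']

/-- **Exponent bookkeeping of Bamler's Gaussian lemma** ([Bamler 2020a, §7.3, (7.25)–(7.26)]).
Given `β, ε, Q, θ, τ, σ > 0`, `H ≥ 0`, `σ ≤ τ`, non-negative distances `d, dv, d₁, d₂` with
`d ≤ d₁ + d₂ + dv + 2 √(H θ τ)`, and the parameter choices
`(1 + β)³ / (8 + ε/2) ≤ 1/8` and `3 (1 + β)³ / (β (8 + ε/2)) ≤ β / (Q θ)`, the exponent
`(1 + β) d² / ((8 + ε/2) τ) - dv² / (8 σ) - β (d₁² + d₂²) / (Q θ τ)` is at most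
`-β (1 + β) d² / ((8 + ε/2) τ) + 12 H θ (1 + β)³ / (β (8 + ε/2))`.
[cite: Bamler2020Entropy, §7.3, (7.25)–(7.26)] -/
theorem gaussianLemma_exponent_le {β ε Q θ H τ σ d dv d₁ d₂ : ℝ} (hβ : 0 < β) (hε : 0 < ε)
    (hQ : 0 < Q) (hθ : 0 < θ) (hH : 0 ≤ H) (hτ : 0 < τ) (hσ : 0 < σ) (hστ : σ ≤ τ) (hd : 0 ≤ d)
    (_hdv : 0 ≤ dv) (hd₁ : 0 ≤ d₁) (hd₂ : 0 ≤ d₂) (h1 : (1 + β) ^ 3 / (8 + ε / 2) ≤ 1 / 8)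
    (h2 : 3 * (1 + β) ^ 3 / (β * (8 + ε / 2)) ≤ β / (Q * θ))
    (htri : d ≤ d₁ + d₂ + dv + 2 * Real.sqrt (H * θ * τ)) :
    (1 + β) * d ^ 2 / ((8 + ε / 2) * τ) - dv ^ 2 / (8 * σ) - β * (d₁ ^ 2 + d₂ ^ 2) / (Q * θ * τ) ≤
      -β * (1 + β) * d ^ 2 / ((8 + ε / 2) * τ) + 12 * H * θ * (1 + β) ^ 3 / (β * (8 + ε / 2)) := by
  have hE : 0 < 8 + ε / 2 := by linarith
  have hβne : β ≠ 0 := hβ.ne'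
  have hτne : τ ≠ 0 := hτ.ne'
  have hEne : 8 + ε / 2 ≠ 0 := hE.ne'
  have hQne : Q ≠ 0 := hQ.ne'
  have hθne : θ ≠ 0 := hθ.ne'
  -- (7.25), first half
  have hd2 : d ^ 2 ≤ (1 + β) * dv ^ 2 + 3 * (1 + 1 / β) * (d₁ ^ 2 + d₂ ^ 2 + 4 * (H * θ * τ)) :=
    gaussianLemma_sq_le hβ hH hθ.le hτ.le hd hd₁ hd₂ htri
  -- multiply by `(1 + β)²`
  have hkey : (1 + β) ^ 2 * d ^ 2 ≤ (1 + β) ^ 3 * dv ^ 2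
      + 3 * (1 + β) ^ 3 / β * (d₁ ^ 2 + d₂ ^ 2) + 12 * (1 + β) ^ 3 / β * (H * θ * τ) := by
    have h := mul_le_mul_of_nonneg_left hd2 (sq_nonneg (1 + β))
    have hid : (1 + β) ^ 2 * ((1 + β) * dv ^ 2
        + 3 * (1 + 1 / β) * (d₁ ^ 2 + d₂ ^ 2 + 4 * (H * θ * τ))) = (1 + β) ^ 3 * dv ^ 2
        + 3 * (1 + β) ^ 3 / β * (d₁ ^ 2 + d₂ ^ 2) + 12 * (1 + β) ^ 3 / β * (H * θ * τ) := by
      field_simp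
      ring
    rw [hid] at h
    exact h
  -- divide by `(8 + ε/2) τ`
  have hD : 0 < (8 + ε / 2) * τ := mul_pos hE hτ
  have hdiv : (1 + β) ^ 2 * d ^ 2 / ((8 + ε / 2) * τ) ≤
      (1 + β) ^ 3 / (8 + ε / 2) * (dv ^ 2 / τ)
        + 3 * (1 + β) ^ 3 / (β * (8 + ε / 2)) * ((d₁ ^ 2 + d₂ ^ 2) / τ)
        + 12 * H * θ * (1 + β) ^ 3 / (β * (8 + ε / 2)) := by
    have h := div_le_div_of_nonneg_right hkey hD.le
    have hid : ((1 + β) ^ 3 * dv ^ 2 + 3 * (1 + β) ^ 3 / β * (d₁ ^ 2 + d₂ ^ 2)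
        + 12 * (1 + β) ^ 3 / β * (H * θ * τ)) / ((8 + ε / 2) * τ) =
        (1 + β) ^ 3 / (8 + ε / 2) * (dv ^ 2 / τ)
          + 3 * (1 + β) ^ 3 / (β * (8 + ε / 2)) * ((d₁ ^ 2 + d₂ ^ 2) / τ)
          + 12 * H * θ * (1 + β) ^ 3 / (β * (8 + ε / 2)) := by
      field_simp
    rw [hid] at h
    exact h
  -- absorb the `dv²` term (first parameter choice and `σ ≤ τ`)
  have hA : (1 + β) ^ 3 / (8 + ε / 2) * (dv ^ 2 / τ) ≤ dv ^ 2 / (8 * σ) := by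
    have hdvτ : 0 ≤ dv ^ 2 / τ := div_nonneg (sq_nonneg _) hτ.le
    calc (1 + β) ^ 3 / (8 + ε / 2) * (dv ^ 2 / τ) ≤ 1 / 8 * (dv ^ 2 / τ) :=
          mul_le_mul_of_nonneg_right h1 hdvτ
      _ = dv ^ 2 / (8 * τ) := by rw [div_mul_div_comm, one_mul]
      _ ≤ dv ^ 2 / (8 * σ) :=
          div_le_div_of_nonneg_left (sq_nonneg _) (by positivity) (by linarith)
  -- absorb the `d₁² + d₂²` term (second parameter choice)
  have hB : 3 * (1 + β) ^ 3 / (β * (8 + ε / 2)) * ((d₁ ^ 2 + d₂ ^ 2) / τ) ≤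
      β * (d₁ ^ 2 + d₂ ^ 2) / (Q * θ * τ) := by
    have hPτ : 0 ≤ (d₁ ^ 2 + d₂ ^ 2) / τ := div_nonneg (by positivity) hτ.le
    calc 3 * (1 + β) ^ 3 / (β * (8 + ε / 2)) * ((d₁ ^ 2 + d₂ ^ 2) / τ)
        ≤ β / (Q * θ) * ((d₁ ^ 2 + d₂ ^ 2) / τ) := mul_le_mul_of_nonneg_right h2 hPτ
      _ = β * (d₁ ^ 2 + d₂ ^ 2) / (Q * θ * τ) := by rw [div_mul_div_comm]
  -- the splitting `(1 + β) d² = -β (1 + β) d² + (1 + β)² d²`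
  have hsplit : (1 + β) * d ^ 2 / ((8 + ε / 2) * τ) =
      -β * (1 + β) * d ^ 2 / ((8 + ε / 2) * τ) + (1 + β) ^ 2 * d ^ 2 / ((8 + ε / 2) * τ) := by
    ring
  linarith [hdiv, hA, hB, hsplit]

end Literature.Geometry.Riemannian

end
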